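import Summits.Langlands.Langlands.Theorems.LevelOneDyadicTower

/-!
Part 4/4 of the support module of the decomp-langlands lens-4 nodes g6 `LevelOneNormalForm` + g7 `DyadicCompanion` for
route-Langlands-MinimalLevelDescent rev 3 (crux Z = `MinimalLevelDescent.LevelOneCrystallineDescent`, stmt-Langlands-31277):
the 1239-line candidate `nodes/lens-4-g7-DyadicCompanion.module.lean` (rc 0 · 0 sorry) CUT by topic at the gate's request
(census REPLY 2026-08-30T09:08:07Z: theorem files ≤ 400 lines, statement-only file ≤ 1000, docstring on every decl), SAME namespace
`Summit.Langlands.Langlands.Theorems.LevelOneDyadic` in all four parts so that every kernel theorem keeps its name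
(`LevelOneDyadic.item_31277_of_pieces`, `…dyadicLevelOneCompanion_iff_pieces`, `…_of_langlands`).  0 sorry; axioms standard.

# Part 4 — THE DYADIC KERNEL: local Weil–Deligne bookkeeping (`N_eq_zero_of_equiv`, `recipe_inertia_eq_one`, …), the
local–global chain `isUnramifiedAt_of_localGlobal_pair` / `isUnramifiedAwayFrom_of_corresponds`, and the structure theorems
C₂ ⟺ E ∧ I ∧ U (`dyadicLevelOneCompanion_iff_pieces`), C₂ ⟹ Z, E ⟸ item 18969, NECESSITY Langlands ⟹ C₂/E/I/U,
`item_31277_of_pieces : E → I → U → MinimalLevelDescent.LevelOneCrystallineDescent` (THE TREE ITEM BY NAME), the n = 1 rung of I,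
and the deciding theorems `langlands_of_pieces` / `langlands_of_pieces_tree` / `langlands_of_tower_pieces`.
(`levelPrimeDescent_of_resplit_holds` of the uncut module is dropped: it is the landed `Theorems.LevelPrimeDescent_of_resplit_proof`.)
-/

set_option linter.dupNamespace false

namespace Summit.Langlands.Langlands.Theorems.LevelOneDyadic

open scoped NumberField
open Filter IsDedekindDomain Polynomial
open Literature.NumberTheory.GaloisRepresentations Literature.NumberTheory.Automorphic
open Summit.Langlands.Langlands.Theses

variable {K : Type} [Field K] [NumberField K] {ℓ : ℕ} [Fact ℓ.Prime] {n : ℕ}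

/-! ## Local Weil–Deligne bookkeeping: "unramified with N = 0" is reflected by isomorphism, by transport along ι, by the
Grothendieck–Deligne recipe and by passage to the local Galois group (the converses of the tree file
`WeilDeligneOfGaloisUnramifiedProofs`, which proves the forward directions). -/

section WD

variable {F : Type*} [Field F] [ValuativeRel F] [TopologicalSpace F] [IsNonarchimedeanLocalField F]
  {C : Type*} [Field C] [CharZero C] {V V' : Type*} [AddCommGroup V] [Module C V] [AddCommGroup V'] [Module C V']
  {r : WeilDeligneRep F C V} {r' : WeilDeligneRep F C V'}

/-- An isomorphism of Weil–Deligne representations reflects `N = 0`. [cite: DeligneAntwerpII1973, §8.4.1] -/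
theorem N_eq_zero_of_equiv (e : WeilDeligneRep.Equiv r r') (h : r'.N = 0) : r.N = 0 := by
  have hc : e.toLinearMap ∘ₗ r.N = r'.N ∘ₗ e.toLinearMap := e.comm_N
  rw [h, LinearMap.zero_comp] at hc
  refine LinearMap.ext fun v => ?_
  have hv : e.toLinearMap (r.N v) = 0 := by simpa using LinearMap.congr_fun hc v
  have hcoe : ∀ x, e.toLinearEquiv x = e.toLinearMap x := fun _ => rfl
  have h2 : e.toLinearEquiv (r.N v) = e.toLinearEquiv 0 := by rw [hcoe, hcoe, hv, map_zero]
  simpa using e.toLinearEquiv.injective h2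

/-- An isomorphism of Weil–Deligne representations reflects "trivial on inertia". [cite: DeligneAntwerpII1973, §8.4.1] -/
theorem isUnramifiedRep_of_equiv (e : WeilDeligneRep.Equiv r r') (h : WeilGroup.IsUnramifiedRep r'.ρ) :
    WeilGroup.IsUnramifiedRep r.ρ := by
  intro u hu
  have hc : e.toLinearMap ∘ₗ r.ρ u = r'.ρ u ∘ₗ e.toLinearMap := e.isIntertwining' u
  rw [h u hu] at hc
  refine LinearMap.ext fun v => ?_
  have hv : e.toLinearMap (r.ρ u v) = e.toLinearMap v := by simpa using LinearMap.congr_fun hc v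
  have hcoe : ∀ x, e.toLinearEquiv x = e.toLinearMap x := fun _ => rfl
  have h2 : e.toLinearEquiv (r.ρ u v) = e.toLinearEquiv v := by rw [hcoe, hcoe, hv]
  simpa using e.toLinearEquiv.injective h2

/-- A Weil–Deligne representation whose Frobenius-semisimplification class is the class of an UNRAMIFIED parameter (`N = 0`,
inertia trivial) is itself unramified with `N = 0` (a Frobenius-semisimplification keeps `N` and the restriction to inertia;
isomorphic representations are unramified together). [cite: DeligneAntwerpII1973, §8.6] [cite: TateCorvallis1979, (4.1.3)] -/
theorem unramified_of_hasFrobSemisimpleClass {s : WeilDeligneRep F ℂ (Fin n → ℂ)}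
    {c : Quotient (frobSemisimpleWDSetoid F n)} (hs : s.HasFrobSemisimpleClass c)
    {r₁ : WeilDeligneRep F ℂ (Fin n → ℂ)} (hr₁ : r₁.IsFrobSemisimple)
    (hc : Quotient.mk (frobSemisimpleWDSetoid F n) ⟨r₁, hr₁⟩ = c) (hN : r₁.N = 0)
    (hur : WeilGroup.IsUnramifiedRep r₁.ρ) : s.N = 0 ∧ WeilGroup.IsUnramifiedRep s.ρ := by
  obtain ⟨r₂, hss, hc₂⟩ := hs
  have heqv : r₂.IsEquivalent r₁ := Quotient.exact (hc₂.trans hc.symm)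
  obtain ⟨e⟩ := heqv
  exact ⟨hss.1.symm.trans (N_eq_zero_of_equiv e hN),
    fun u hu => (hss.2.1 u hu).symm.trans (isUnramifiedRep_of_equiv e hur u hu)⟩

variable {E : Type*} [Field E] [CharZero E]

/-- Transport along an (injective) `ι : E →+* C` reflects `N = 0`. [cite: DeligneAntwerpII1973, §8.4.3] -/
theorem N_eq_zero_of_isTransportAlong {ι : E →+* C} {r : WeilDeligneRep F E (Fin n → E)}
    {rC : WeilDeligneRep F C (Fin n → C)} (hT : r.IsTransportAlong ι rC) (hN : rC.N = 0) : r.N = 0 := by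
  have h := hT.2
  rw [hN, map_zero] at h
  have h0 : (LinearMap.toMatrix' r.N).map ι = (0 : Matrix (Fin n) (Fin n) E).map ι := by
    rw [← h, Matrix.map_zero _ (map_zero ι)]
  exact (LinearEquiv.map_eq_zero_iff LinearMap.toMatrix').mp (Matrix.map_injective ι.injective h0)

/-- Transport along an (injective) `ι : E →+* C` reflects "trivial on inertia". [cite: DeligneAntwerpII1973, §8.4.3] -/
theorem isUnramifiedRep_of_isTransportAlong {ι : E →+* C} {r : WeilDeligneRep F E (Fin n → E)}
    {rC : WeilDeligneRep F C (Fin n → C)} (hT : r.IsTransportAlong ι rC) (h : WeilGroup.IsUnramifiedRep rC.ρ) :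
    WeilGroup.IsUnramifiedRep r.ρ := by
  intro u hu
  have h1 := hT.1 u
  rw [h u hu, LinearMap.toMatrix'_one] at h1
  have h2 : (LinearMap.toMatrix' (r.ρ u)).map ι = (1 : Matrix (Fin n) (Fin n) E).map ι := by
    rw [← h1, Matrix.map_one _ (map_zero ι) (map_one ι)]
  have h3 := Matrix.map_injective ι.injective h2
  rw [← LinearMap.toMatrix'_one] at h3
  exact LinearMap.toMatrix'.injective h3

/-- **The recipe at `N = 0`, unramified `ρ_WD`: `ρW` is trivial on inertia** (clause (iii) of `IsWeilDeligneOfLadic` at `m = 0`: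
`[ρ_WD(u)] = ρW(u) · exp(-t(u) N)`). [cite: TateCorvallis1979, (4.2.1)] [cite: DeligneAntwerpII1973, §8.4.2] -/
theorem recipe_inertia_eq_one {ρW : WeilGroup F →* GL (Fin n) E} {r : WeilDeligneRep F E (Fin n → E)}
    (h : IsWeilDeligneOfLadic ρW r) (hN : r.N = 0) (hur : WeilGroup.IsUnramifiedRep r.ρ) :
    ∀ u ∈ WeilGroup.inertia F, ρW u = 1 := by
  intro u hu
  obtain ⟨t, U, Φ, -, -, -, -, -, h3⟩ := h
  have key := h3 0 ⟨u, hu⟩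
  simp only [zpow_zero, one_mul, hN, map_zero, smul_zero, neg_zero, IsNilpotent.exp_zero, mul_one] at key
  rw [hur u hu, LinearMap.toMatrix'_one] at key
  exact Units.ext (by rw [Units.val_one]; exact key.symm)

end WD

section GlobalWD

/-- **`r|_{W_{K_v}}` trivial on inertia ⟹ `r` unramified at `v`** (the converse of the tree's
`FramedGaloisRep.toWeilGroupHom_toLocal_eq_one_of_isUnramifiedAt`; `WeilGroup.inertia_map_toAbsGalois`: the Weil inertia IS
the Galois inertia). [cite: TateCorvallis1979, (1.4.1)] [cite: SerreAbelianLadic1968, Ch. I §2.1] -/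
theorem isUnramifiedAt_of_toWeilGroupHom {A : Type*} [CommRing A] [TopologicalSpace A] [IsTopologicalRing A]
    (r : FramedGaloisRep K A n) {v : HeightOneSpectrum (𝓞 K)}
    (h : ∀ u ∈ WeilGroup.inertia (v.adicCompletion K), (r.toLocal v).toWeilGroupHom u = 1) : r.IsUnramifiedAt v := by
  rw [← r.isUnramifiedAt_toGaloisRep_iff v, GaloisRep.isUnramifiedAt_iff_toLocal_holds v r.toGaloisRep]
  intro σ hσ
  rw [← WeilGroup.inertia_map_toAbsGalois] at hσ
  obtain ⟨u, hu, rfl⟩ := Subgroup.mem_map.mp hσ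
  have h1 := h u hu
  rw [FramedRep.toWeilGroupHom_apply, FramedGaloisRep.toLocal_apply] at h1
  change FramedRep.toRepresentation r
    (absGaloisRestrict K (v.adicCompletion K) (WeilGroup.toAbsGalois (v.adicCompletion K) u)) = 1
  rw [FramedRep.toRepresentation_apply_eq_one_iff]
  exact h1

variable {p : ℕ} [Fact p.Prime]

/-- **UNRAMIFIEDNESS PASSES BETWEEN TWO GALOIS CORRESPONDENTS OF ONE π** (every rank; no sphericity, no genericity).  Let ρ
(ℓ-adic) and ρ₂ (p-adic) both be locally–globally compatible with π at w (summit clause `LocalGlobalCompatibleAt`, same reciprocity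
datum), ρ unramified at w if w ∤ ℓ and CRYSTALLINE at w if w ∣ ℓ, and w ∤ p.  Then ρ₂ is unramified at w.  Chain: WD(ρ|w) is
unramified with N = 0 (the recipe, resp. Fontaine's datum: `PstWeilDeligneData.isEquivalent` against the crystalline witness) ⟹
so is its transport ⟹ rec(π_w) is the class of an unramified parameter (`HasFrobSemisimpleClass.exists_of_isUnramifiedRep`) ⟹
(local components are unique, `hasLocalComponentAt_unique_holds`) so is the class of ι₂ WD(ρ₂|w)^{F-ss} ⟹ WD(ρ₂|w) is unramified
with N = 0 (`unramified_of_hasFrobSemisimpleClass`; transport reflects) ⟹ ρ₂|W_{K_w} is trivial on inertia (recipe at N = 0) ⟹ ρ₂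
is unramified at w. [cite: TateCorvallis1979, (4.2.1)] [cite: DeligneAntwerpII1973, §8] -/
theorem isUnramifiedAt_of_localGlobal_pair {Rec : ReciprocityData K} {hcpt : isCompact_glFiniteIntegralLevel n K}
    {π : CuspidalAutomorphicRepData n K hcpt} {ι : PadicAlgCl ℓ ≃+* ℂ} {ρ : FramedGaloisRep K (PadicAlgCl ℓ) n}
    {ι₂ : PadicAlgCl p ≃+* ℂ} {ρ₂ : FramedGaloisRep K (PadicAlgCl p) n} (w : HeightOneSpectrum (𝓞 K))
    (h₁ : LocalGlobalCompatibleAt Rec ι π.1 ρ w) (h₂ : LocalGlobalCompatibleAt Rec ι₂ π.1 ρ₂ w)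
    (hρ : ((ℓ : ℕ) : 𝓞 K) ∉ w.asIdeal → ρ.IsUnramifiedAt w)
    (hρ' : ∀ hw : ((ℓ : ℕ) : 𝓞 K) ∈ w.asIdeal,
      (Literature.NumberTheory.PAdicHodge.fontainePstAdicCompletion w ℓ hw).IsCrystallineFramed (ρ.toLocal w))
    (hp : ((p : ℕ) : 𝓞 K) ∉ w.asIdeal) : ρ₂.IsUnramifiedAt w := by
  obtain ⟨πv, r, rC, hπv, haway, habove, hT, hcls⟩ := h₁
  obtain ⟨πv₂, r₂, rC₂, hπv₂, haway₂, -, hT₂, hcls₂⟩ := h₂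
  have hr : r.N = 0 ∧ WeilGroup.IsUnramifiedRep r.ρ := by
    by_cases hw : ((ℓ : ℕ) : 𝓞 K) ∈ w.asIdeal
    · obtain ⟨-, r₀, hr₀, hN₀, hur₀⟩ := hρ' hw
      obtain ⟨e⟩ := (Rec.pst ℓ w hw).isEquivalent (ρ.toLocal w) r₀ r hr₀ (habove hw)
      exact ⟨N_eq_zero_of_equiv e.symm hN₀, isUnramifiedRep_of_equiv e.symm hur₀⟩
    · have hI := ρ.toWeilGroupHom_toLocal_eq_one_of_isUnramifiedAt (hρ hw)
      exact ⟨(haway hw).N_eq_zero_of_forall_inertia hI, (haway hw).isUnramifiedRep_of_forall_inertia hI⟩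
  obtain ⟨r', hr', hc, hN', hur'⟩ := hcls.exists_of_isUnramifiedRep (hT.N_eq_zero hr.1) (hT.isUnramifiedRep hr.2)
  have hπvv : IrrClass.mk πv₂ = IrrClass.mk πv :=
    AutomorphicRepData.hasLocalComponentAt_unique_holds π.1 w πv₂ πv hπv₂ hπv
  rw [hπvv] at hcls₂
  have h4 := unramified_of_hasFrobSemisimpleClass hcls₂ hr' hc hN' hur'
  exact isUnramifiedAt_of_toWeilGroupHom ρ₂
    (recipe_inertia_eq_one (haway₂ hp) (N_eq_zero_of_isTransportAlong hT₂ h4.1) (isUnramifiedRep_of_isTransportAlong hT₂ h4.2))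

/-- Two correspondents of one π: if the ℓ-adic one is crystalline above ℓ and unramified away from ℓ, the p-adic one is unramified
away from p (LEVEL ONE is a property of π, read back on every correspondent). -/
theorem isUnramifiedAwayFrom_of_corresponds {Rec : ReciprocityData K} {hcpt : isCompact_glFiniteIntegralLevel n K}
    {π : CuspidalAutomorphicRepData n K hcpt} {ι : PadicAlgCl ℓ ≃+* ℂ} {ρ : FramedGaloisRep K (PadicAlgCl ℓ) n}
    {ι₂ : PadicAlgCl p ≃+* ℂ} {ρ₂ : FramedGaloisRep K (PadicAlgCl p) n}
    (h₁ : Corresponds Rec ι π.1 ρ) (h₂ : Corresponds Rec ι₂ π.1 ρ₂) (hlev : IsUnramifiedAwayFrom ρ) (hcrys : IsCrystallineAbove ρ) :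
    IsUnramifiedAwayFrom ρ₂ :=
  fun w hw => isUnramifiedAt_of_localGlobal_pair w (h₁.2 w) (h₂.2 w) (hlev w) (fun hw' => hcrys w hw') hw

end GlobalWD

/-! ## STRUCTURE: C₂ ⟺ E ∧ I ∧ U (kernel), C₂ ⟹ Z (kernel), E ⟸ item 18969 (kernel), NECESSITY Langlands ⟹ C₂, E, I, U (kernel) -/

section Structure

/-- Glue of the split: E → I → U → C₂ (pure logic: the companion of E is irreducible by I and level one by U). -/
theorem dyadicLevelOneCompanion_of_pieces (hE : DyadicCompanionExistence) (hI : DyadicIrreducibilityTransfer)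
    (hU : DyadicLevelTransfer) : DyadicLevelOneCompanion := by
  rw [dyadicLevelOneCompanion_iff]
  rw [dyadicCompanionExistence_iff] at hE
  rw [dyadicIrreducibilityTransfer_iff] at hI
  rw [dyadicLevelTransfer_iff] at hU
  intro K _ _ n hn ℓ _ hℓ2 ι ρ hirr hgeo hcrys hlev ι₂
  obtain ⟨ρ₂, hgeo₂, hm⟩ := hE K n hn ℓ hℓ2 ι ρ hirr hgeo hcrys hlev ι₂
  have hirr₂ := hI K n hn ℓ hℓ2 ι ρ hirr hgeo hcrys hlev ι₂ ρ₂ hgeo₂ hm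
  exact ⟨ρ₂, hirr₂, hgeo₂, hU K n hn ℓ hℓ2 ι ρ hirr hgeo hcrys hlev ι₂ ρ₂ hirr₂ hgeo₂ hm, hm⟩

/-- C₂ → E (drop irreducibility and the level). -/
theorem dyadicCompanionExistence_of_companion (hC : DyadicLevelOneCompanion) : DyadicCompanionExistence := by
  rw [dyadicCompanionExistence_iff]
  rw [dyadicLevelOneCompanion_iff] at hC
  intro K _ _ n hn ℓ _ hℓ2 ι ρ hirr hgeo hcrys hlev ι₂
  obtain ⟨ρ₂, -, hgeo₂, -, hm⟩ := hC K n hn ℓ hℓ2 ι ρ hirr hgeo hcrys hlev ι₂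
  exact ⟨ρ₂, hgeo₂, hm⟩

/-- C₂ → I (Chebotarev + Brauer–Nesbitt, tree theorem `IrreducibleOffSector.isIrreducible_of_eventually_hasFrobCharpolyAt_common`: ρ₂ and
the irreducible companion share their Frobenius polynomials a.e.). -/
theorem dyadicIrreducibilityTransfer_of_companion (hC : DyadicLevelOneCompanion) : DyadicIrreducibilityTransfer := by
  rw [dyadicIrreducibilityTransfer_iff]
  rw [dyadicLevelOneCompanion_iff] at hC
  intro K _ _ n hn ℓ _ hℓ2 ι ρ hirr hgeo hcrys hlev ι₂ ρ₂ hgeo₂ hm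
  obtain ⟨ρ₁, hirr₁, hgeo₁, -, hm₁⟩ := hC K n hn ℓ hℓ2 ι ρ hirr hgeo hcrys hlev ι₂
  exact Summit.Langlands.Langlands.Theorems.IrreducibleOffSector.isIrreducible_of_eventually_hasFrobCharpolyAt_common hirr₁
    (eventually_common_of_match hm₁ hm hgeo₁.1 hgeo₂.1)

/-- C₂ → U (Deligne–Serre conjugacy `exists_conj_of_match`: an irreducible ρ₂ matching ρ is conjugate to the level-one companion,
and unramifiedness is a conjugacy invariant). -/
theorem dyadicLevelTransfer_of_companion (hC : DyadicLevelOneCompanion) : DyadicLevelTransfer := by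
  rw [dyadicLevelTransfer_iff]
  rw [dyadicLevelOneCompanion_iff] at hC
  intro K _ _ n hn ℓ _ hℓ2 ι ρ hirr hgeo hcrys hlev ι₂ ρ₂ _ hgeo₂ hm
  obtain ⟨ρ₁, hirr₁, hgeo₁, hlev₁, hm₁⟩ := hC K n hn ℓ hℓ2 ι ρ hirr hgeo hcrys hlev ι₂
  obtain ⟨P, rfl⟩ := exists_conj_of_match hirr₁ (eventually_common_of_match hm₁ hm hgeo₁.1 hgeo₂.1)
  exact isUnramifiedAwayFrom_conj P hlev₁

/-- EXACTNESS of the split: C₂ ⟺ E ∧ I ∧ U. -/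
theorem dyadicLevelOneCompanion_iff_pieces :
    DyadicLevelOneCompanion ↔ DyadicCompanionExistence ∧ DyadicIrreducibilityTransfer ∧ DyadicLevelTransfer :=
  ⟨fun h => ⟨dyadicCompanionExistence_of_companion h, dyadicIrreducibilityTransfer_of_companion h,
      dyadicLevelTransfer_of_companion h⟩,
    fun h => dyadicLevelOneCompanion_of_pieces h.1 h.2.1 h.2.2⟩

/-- The slice n = 1 of I holds outright (a line is irreducible, `IrreducibleOffSector.isIrreducible_of_rank_one`). -/
theorem dyadicIrreducibilityTransfer_rank_one {K : Type} [Field K] [NumberField K] (ρ₂ : FramedGaloisRep K (PadicAlgCl 2) 1) :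
    ρ₂.toGaloisRep.IsIrreducible :=
  Summit.Langlands.Langlands.Theorems.IrreducibleOffSector.isIrreducible_of_rank_one ρ₂

/-- **E ⟸ the OPEN ITEM stmt-Langlands-18969** (`CompatibleFamilySplit.GeometricCompanions`, crux rank 3 of
route-Langlands-CompatibleFamilySplit), by name: its slice at ℓ′ = 2 for level-one crystalline ρ, with the uniform Satake function a
folded into the matching and semisimplicity forgotten. -/
theorem dyadicCompanionExistence_of_geometricCompanions (h : CompatibleFamilySplit.GeometricCompanions) :
    DyadicCompanionExistence := by
  rw [dyadicCompanionExistence_iff]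
  intro K _ _ n hn ℓ _ hℓ2 ι ρ hirr hgeo hcrys hlev ι₂
  obtain ⟨a, hρa, hall⟩ := h K n hn ℓ ι ρ hirr ⟨hgeo.1, fun v hv => hgeo.2 v hv⟩
  obtain ⟨ρ₂, -, hgeo₂, hρ₂a⟩ := hall 2 ι₂
  refine ⟨ρ₂, ⟨hgeo₂.1, fun v hv => hgeo₂.2 v hv⟩, ?_⟩
  filter_upwards [hρa, hρ₂a] with v ⟨_, hv⟩ ⟨_, hv₂⟩
  exact ⟨a v, hv, hv₂⟩

/-- **C₂ ⟹ Z** (the companion switch).  Inside Z's frame: take ρ₂ (C₂, with ι₂ from Steinitz `PadicAlgCl.nonempty_ringEquiv_complex`);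
Z's induction hypothesis AT THE SINGLE PRIME ℓ′ = 2 (< ℓ, ℓ odd) makes ρ₂ residually automorphic; Lift_w + W⁺ at the prime 2
(`automorphic_of_residual`) give π Satake-compatible with (ρ₂, ι₂); the matching carries the compatibility back to (ρ, ι)
(`eventually_satake_of_match'`); automorphic ⟹ residually automorphic. -/
theorem levelOneCrystallineDescent_of_companion (hC : DyadicLevelOneCompanion) : LevelOneCrystallineDescent := by
  rw [levelOneCrystallineDescent_iff]
  rw [dyadicLevelOneCompanion_iff] at hC
  intro hW hL ℓ _ hℓ2 hIH K _ _ n hcpt hn ι ρ hirr hgeo hcrys hlev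
  obtain ⟨ι₂⟩ := PadicAlgCl.nonempty_ringEquiv_complex 2
  obtain ⟨ρ₂, hirr₂, hgeo₂, hlev₂, hm⟩ := hC K n hn ℓ hℓ2 ι ρ hirr hgeo hcrys hlev ι₂
  have h2ℓ : 2 < ℓ := lt_of_le_of_ne (Fact.out : ℓ.Prime).two_le (Ne.symm hℓ2)
  have hres₂ : IsResiduallyAutomorphic hcpt ι₂ ρ₂ := hIH 2 h2ℓ K n hcpt hn ι₂ ρ₂ hirr₂ hgeo₂ hlev₂
  obtain ⟨π, hLπ, hπ₂⟩ := automorphic_of_residual hW hL hcpt hn ι₂ ρ₂ hirr₂ hgeo₂ hres₂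
  exact isResiduallyAutomorphic_of_satakeCompatible hcpt ι ρ ⟨π, hLπ, eventually_satake_of_match' π hπ₂ hm hgeo.1⟩

/-- **Z ⟸ E ∧ I ∧ U** — the node's glue. -/
theorem levelOneCrystallineDescent_of_pieces (hE : DyadicCompanionExistence) (hI : DyadicIrreducibilityTransfer)
    (hU : DyadicLevelTransfer) : LevelOneCrystallineDescent :=
  levelOneCrystallineDescent_of_companion (dyadicLevelOneCompanion_of_pieces hE hI hU)

/-- `Langlands ⟹ C₂`: (B) at ℓ gives π; (A) at 2 gives an irreducible geometric correspondent ρ₂; level one passes from ρ to ρ₂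
through π (`isUnramifiedAwayFrom_of_corresponds`); the two Satake clauses give the matching. -/
theorem dyadicLevelOneCompanion_of_langlands (hLg : _root_.Langlands) : DyadicLevelOneCompanion := by
  rw [dyadicLevelOneCompanion_iff]
  intro K _ _ n hn ℓ _ hℓ2 ι ρ hirr hgeo hcrys hlev ι₂
  obtain ⟨⟨Rec⟩, h⟩ := hLg K
  have hcpt : isCompact_glFiniteIntegralLevel n K := isCompact_glFiniteIntegralLevel_holds n K
  obtain ⟨hA, hB⟩ := h Rec n hn hcpt
  obtain ⟨π, hLπ, hcorr⟩ := hB ℓ ι ρ hirr ⟨hgeo.1, fun v hv => hgeo.2 v hv⟩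
  obtain ⟨ρ₂, hirr₂, hgeo₂, hcorr₂, -⟩ := hA π hLπ 2 ι₂
  exact ⟨ρ₂, hirr₂, ⟨hgeo₂.1, fun v hv => hgeo₂.2 v hv⟩, isUnramifiedAwayFrom_of_corresponds hcorr hcorr₂ hlev hcrys,
    companionMatch_of_satake π hcorr.1 hcorr₂.1⟩

/-- `Langlands ⟹ E`. -/
theorem dyadicCompanionExistence_of_langlands (hLg : _root_.Langlands) : DyadicCompanionExistence :=
  dyadicCompanionExistence_of_companion (dyadicLevelOneCompanion_of_langlands hLg)

/-- `Langlands ⟹ I` (through C₂; equivalently `IrreducibleOffSector.isIrreducible_of_langlands` at the prime 2). -/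
theorem dyadicIrreducibilityTransfer_of_langlands (hLg : _root_.Langlands) : DyadicIrreducibilityTransfer :=
  dyadicIrreducibilityTransfer_of_companion (dyadicLevelOneCompanion_of_langlands hLg)

/-- `Langlands ⟹ U` (through C₂: the WD chain + Deligne–Serre conjugacy). -/
theorem dyadicLevelTransfer_of_langlands (hLg : _root_.Langlands) : DyadicLevelTransfer :=
  dyadicLevelTransfer_of_companion (dyadicLevelOneCompanion_of_langlands hLg)

/-! ## BY-NAME IDENTITY WITH THE TREE ITEMS OF RECORD (route-Langlands-MinimalLevelDescent rev 3 @db305037fe3b) -/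

/-- Z of this file IS the tree item stmt-Langlands-31277 (byte-identical text). -/
theorem levelOneCrystallineDescent_iff_item_31277 :
    LevelOneCrystallineDescent ↔ MinimalLevelDescent.LevelOneCrystallineDescent :=
  Iff.rfl

/-- K of this file IS the tree item stmt-Langlands-31276 (byte-identical text). -/
theorem residualInertiaDescent_iff_item_31276 :
    ResidualInertiaDescent ↔ MinimalLevelDescent.ResidualInertiaDescent :=
  Iff.rfl

/-- **THE TREE ITEM Z (31277) FROM THE THREE DYADIC PIECES.** -/
theorem item_31277_of_pieces (hE : DyadicCompanionExistence) (hI : DyadicIrreducibilityTransfer) (hU : DyadicLevelTransfer) :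
    MinimalLevelDescent.LevelOneCrystallineDescent :=
  levelOneCrystallineDescent_of_pieces hE hI hU

/-- `closes₇` THROUGH THE TREE: E I U + the tree items K 31276, W 31274, L 31275, glue 31278 and the route of record's `closes`. -/
theorem langlands_of_pieces_tree (hE : DyadicCompanionExistence) (hI : DyadicIrreducibilityTransfer) (hU : DyadicLevelTransfer)
    (hK : MinimalLevelDescent.ResidualInertiaDescent) (hG : MinimalLevelDescent.LevelPrimeDescent_of_resplit)
    (hWM : MinimalLevelDescent.WeightMove) (hLM : MinimalLevelDescent.LevelMove)
    (hB : MinimalLevelDescent.DyadicLevelOneAutomorphy) (hL : MinimalLevelDescent.AutomorphyLifting)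
    (hW : MinimalLevelDescent.SatakeAvatarExistence) (hP : MinimalLevelDescent.PadicMemberCompatibility)
    (hA : MinimalLevelDescent.CompatibilityAwayFromLR) (hR : MinimalLevelDescent.CanonicalReciprocityData) :
    _root_.Langlands :=
  MinimalLevelDescent.closes (hG hWM hLM hK (item_31277_of_pieces hE hI hU)) hB hL hW hP hA hR

-- (the consistency restatement `levelOneCrystallineDescent_of_langlands'` — Langlands ⟹ Z through the dyadic
-- pieces, `levelOneCrystallineDescent_of_companion (dyadicLevelOneCompanion_of_langlands hLg)` — is omitted: its TYPE
-- coincides with part 3's `levelOneCrystallineDescent_of_langlands` (gate dedup.landed); cite that declaration.)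

/-- M₀ (retired 28625, history) from SD ∧ BC ∧ T⁺ ∧ L ∧ E ∧ I ∧ U (g6's `minimalCrystallineDescent_of_line` with Z dissolved). -/
theorem minimalCrystallineDescent_of_line₇ (hSD : SolvableDescent) (hBC : SolvableBaseChange) (hT : ResidualKillingTower)
    (hLM : MinimalLevelDescent.LevelMove) (hE : DyadicCompanionExistence) (hI : DyadicIrreducibilityTransfer)
    (hU : DyadicLevelTransfer) : MinimalCrystallineDescent₀ :=
  minimalCrystallineDescent_of_line hSD hBC hT hLM (levelOneCrystallineDescent_of_pieces hE hI hU)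

/-! ## DECIDING THEOREM of the g7 node -/

/-- `closes₇`: the three new pieces E, I, U in place of Z, then the g6 certificate `closes` verbatim (twelve binders: E I U K W L + the
route of record's B₂ Lift_w W⁺ P L∤R CRD). -/
theorem langlands_of_pieces (hE : DyadicCompanionExistence) (hI : DyadicIrreducibilityTransfer) (hU : DyadicLevelTransfer)
    (hK : ResidualInertiaDescent) (hWM : MinimalLevelDescent.WeightMove) (hLM : MinimalLevelDescent.LevelMove)
    (hB : MinimalLevelDescent.DyadicLevelOneAutomorphy) (hL : MinimalLevelDescent.AutomorphyLifting)
    (hW : MinimalLevelDescent.SatakeAvatarExistence) (hP : MinimalLevelDescent.PadicMemberCompatibility)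
    (hA : MinimalLevelDescent.CompatibilityAwayFromLR) (hR : MinimalLevelDescent.CanonicalReciprocityData) :
    _root_.Langlands :=
  langlands_of_KZ hK (levelOneCrystallineDescent_of_pieces hE hI hU) hWM hLM hB hL hW hP hA hR

/-- `closes₇'`: the same through the g6 tower mechanism for K (fourteen binders: SD-by-item-name BC T⁺ E I U W L + six). -/
theorem langlands_of_tower_pieces (hSD : SolvableReachSplit.SolvableDescent) (hBC : SolvableBaseChange) (hT : ResidualKillingTower)
    (hE : DyadicCompanionExistence) (hI : DyadicIrreducibilityTransfer) (hU : DyadicLevelTransfer)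
    (hWM : MinimalLevelDescent.WeightMove) (hLM : MinimalLevelDescent.LevelMove)
    (hB : MinimalLevelDescent.DyadicLevelOneAutomorphy) (hL : MinimalLevelDescent.AutomorphyLifting)
    (hW : MinimalLevelDescent.SatakeAvatarExistence) (hP : MinimalLevelDescent.PadicMemberCompatibility)
    (hA : MinimalLevelDescent.CompatibilityAwayFromLR) (hR : MinimalLevelDescent.CanonicalReciprocityData) :
    _root_.Langlands :=
  langlands_of_tower_KZ hSD hBC hT (levelOneCrystallineDescent_of_pieces hE hI hU) hWM hLM hB hL hW hP hA hR

end Structure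

end Summit.Langlands.Langlands.Theorems.LevelOneDyadic
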